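import Summits.BirchSwinnertonDyer.BirchSwinnertonDyer.Theorems.SylvesterTwoHeegnerIndexUpperPairForm
import HarnessLib

/-!
# Route `SylvesterTwoHeegnerIndex` (rung K7t), crux `HeegnerIndexUpperAtTwoHSYOfFacts` (item 19476):
# the `𝒱₀` LAYER (`UpperOnV0`) under the cell's `2`-adic index theorem displayed as ONE binder,
# the index-bound form of the crux, and the glue `OnV0 ∧ OffV0 ⇒ crux`

HONEST FRAMING (cell «bsd-cm», `run/shared/lean/pub/bsd-cm/`, D-0033 tranche 1a; D-0074 seat
`bsd-cm-k7t-c2` gen 2; the planner's «UpperOnV0 typing», START-HERE g15 / g14 repair/K7t EDIT-CMD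
«FORESEEN TWO-LAYER PLAN»). The crux (Kolyvagin direction of `BSD(E_p, 2)` on 𝒞_HSY, granted the
route's facts) is OPEN AS A CLASS and stays open here. By the parent file
(`upperOfFacts_iff_pairBound`, binder-free) it is the `2`-adic Kolyvagin inequality for Hu–Shu–Yin's
pair: `ord₂ #Ш(E_p)[2^∞] + ord₂ #Ш(E_{3p²})[2^∞] ≤ ord₂ (#Ш_an(E_p) · #Ш_an(E_{3p²}))`.

THE ONE BINDER `hBC` (section variable, DISPLAYED VERBATIM; no `def`; NOT in print, NOT a Literature
fact, NOT proved here; the planner files it as a route item — K8 `PlusMCEtaK` pattern): for every prime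
`p ≡ 4, 7 (mod 9)` with `3 ∉ 𝔽_p^{×3}` and all globally minimal `B ≅ E_p`, `A ≅ E_{3p²}`,
`#Ш_an(B) = qB`, `#Ш_an(A) = qA` are rational, `qB·qA ≠ 0`, and `ord₂ (qB·qA) = 2n` for some `n : ℕ`.
SOURCE AND STATUS: the cell's REFEREED PAPER THEOREM — MEMO-bsd-cm-two §15.2 Thm B (B-i)
`#Ш_an(E_p) = 2^i N(y)/#Ш(E_{3p²})` with `N(y) = 4^{m(p)}·(odd)` by the odd-index lemma §15.1
(`E_p(K) ⊗ ℤ₂ = ℤ₂[ω]·P`, `K = ℚ(√−3)`, `2` inert: `H¹(⟨c⟩, ℤ₄^×) = 0`), §15.5 Thm C (`p ≡ 7 (mod 9) ⇒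
m(p) ≥ 1`: HSY's CM point is fixed by `σ_{−1}`, an explicit `U₀(3⁵)`-identity), and
`#Ш(E_{3p²}) = #Ш_an(E_{3p²})` (Burungale–Flach 2024): `ord₂ (qB·qA) = i + 2m = 2(m + i/2)` with
`n := m + i/2 ∈ ℕ` (`i = 0 | −2` for `p ≡ 4 | 7`). Refereed inside the cell (REFEREE-SCORE-bsd-cm-two-v2.md
and -v2.2.md: PASS, re-derived), consistent with the certified tables N5′ (136/136 primes ≤ 3000),
N5′-ext (414/414) and k7t-c3's kit j250083 / j250796 (2132 members ≤ 10⁵); it is the exact `2`-adic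
companion of Hu–Shu–Yin's PRINTED clause `ord₃ (qB·qA) = 0` (Thm 1.4) in the same currency. Its inputs
(HSY's CM point as an element of `E_p(ℚ(√−3))`, CM heights as norm forms, Shimura reciprocity on
`X₀(3⁵)`) are outside the tree's currency today (memo R81), which is why it is a binder and not a proof.

Granted `hBC` and the published facts (Hu–Shu–Yin, Burungale–Flach, modularity as named binders):
* **`missingUpperBoundAt_onV0_of_twoAdicPair`** — THE `𝒱₀` LAYER: `Ш(E_p)[2^∞] = 0 ∧ Ш(E_{3p²})[2^∞] = 0
  ⇒ MissingUpperBoundAt B 2` (`0 + 0 ≤ 2n`); with p418375 this is the crux's inequality in every frame.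
* `upperOfFacts_iff_indexBound_of_twoAdicPair` — the crux ⟺ the INDEX BOUND
  `ord₂ #Ш(E_p)[2^∞] + ord₂ #Ш(E_{3p²})[2^∞] ≤ 2 n(p)`: a SHARP (constant-zero) `2`-adic Kolyvagin bound
  for the pair — the XL content (`UpperOffV0`), not in print (Kolyvagin 1990 / McCallum 1991 §1:
  `ord_p #Ш(E/K) ≤ 2 ord_p [E(K) : ℤ y_K]` needs `p` ODD).
* `upperOfFacts_of_twoAdicPair_of_offV0` — GLUE: `hBC` + the displayed OFF-`𝒱₀` piece ⇒ the crux.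
* `even_padicVal_of_twoAdicPair` — parity: `ord₂ #Ш_an(E_p) + ord₂ #Ш(E_{3p²})[2^∞]` is even (memo Cor B1).
* `missingLowerBoundAt_of_pair_unit` — for item 19477: `n(p) = 0 ⇒` the LOWER half at the member
  (binder-free in fact: only the displayed value `ord₂ (qB·qA) = 0` enters).

WHAT THIS IS NOT: not a proof of the crux or of the binder; no per-member claim; nothing booked. The
gate records `upperOfFacts_of_twoAdicPair_of_offV0` as CONDITIONAL (displayed hypotheses, credits
nothing) — that is the intended shape of a two-layer skeleton. References: [HuShuYin2019] Cor. 4.4,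
(bsd) p. 12, Thm. 1.4; [BurungaleFlach2024] Thm. 1.1, Cor. 2; [Kolyvagin1990] Thm. A; [McCallumLMS1991]
§1; [Miller2011LMS] Def. 1.1; parent `…UpperPairForm.lean` (this seat).
-/

set_option autoImplicit false
set_option linter.dupNamespace false

noncomputable section

open scoped Classical

open WeierstrassCurve NumberField Literature.NumberTheory.EllipticCurves
  Literature.NumberTheory.EllipticCurves.Rank1Residual
  Literature.NumberTheory.EllipticCurves.Rank1Residual.Typed
  Literature.NumberTheory.EllipticCurves.HuShuYin2019
  Summit.BirchSwinnertonDyer.Rank1Residual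
  Summit.BirchSwinnertonDyer.BirchSwinnertonDyer.Theses.SylvesterTwoHeegnerIndex

namespace Summit.BirchSwinnertonDyer.BirchSwinnertonDyer.Theorems.SylvesterTwoUpper

section Binder

/-! ### The binder (displayed once, as a section hypothesis) -/

variable
  (hBC : ∀ (p : ℕ), p.Prime → (p % 9 = 4 ∨ p % 9 = 7) → (¬ ∃ x : ZMod p, x ^ 3 = 3) →
    ∀ (A B : WeierstrassCurve ℚ) [A.IsElliptic] [A.IsGloballyMinimal] [B.IsElliptic]
      [B.IsGloballyMinimal], (∃ C : VariableChange ℚ, C • B = cubeSumCurve (p : ℚ)) →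
      (∃ C : VariableChange ℚ, C • A = cubeSumCurve (3 * (p : ℚ) ^ 2)) →
      ∃ qB qA : ℚ, shaAn B = (qB : ℂ) ∧ shaAn A = (qA : ℂ) ∧ qB * qA ≠ 0 ∧
        ∃ n : ℕ, padicValRat 2 (qB * qA) = 2 * n)

include hBC

/-- **THE `𝒱₀` LAYER of the crux, modulo the cell's `2`-adic index theorem.** Granted the displayed
binder `hBC` (module docstring: memo Thm B′/B″ + C in `2`-adic pair currency; NOT in print) and the
published facts (Hu–Shu–Yin, Burungale–Flach, modularity): for every member `B ≅ E_p` and partner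
`A ≅ E_{3p²}` with `#Ш(B)[2^∞] = 1` and `#Ш(A)[2^∞] = 1` (the locus `𝒱₀`; e.g. the certified unit
subclass 𝒰 = {`rk₂ Cl(ℚ(∛4p)) ≤ 1`, `2 ∤ h(ℚ(∛18p))`}, memo Thms A/A′), the Euler-system half
`MissingUpperBoundAt B 2` HOLDS: `0 + 0 ≤ 2n`. The planner's `UpperOnV0`, discharged modulo the one
binder. [cite: HuShuYin2019, Cor. 4.4 and (bsd) p. 12] [cite: BurungaleFlach2024, Thm. 1.1 and Cor. 2]
[cite: Miller2011LMS, Def. 1.1] -/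
theorem missingUpperBoundAt_onV0_of_twoAdicPair
    (hHSY : thm14_threePart_product) (hCM0 : bsdTriple_of_hasCM_of_L_one_ne_zero)
    (hmod : hasEntireLFunction_rat)
    {p : ℕ} (hp : p.Prime) (h9 : p % 9 = 4 ∨ p % 9 = 7) (h3 : ¬ ∃ x : ZMod p, x ^ 3 = 3)
    (A B : WeierstrassCurve ℚ) [A.IsElliptic] [A.IsGloballyMinimal] [B.IsElliptic]
    [B.IsGloballyMinimal] (hB : ∃ C : VariableChange ℚ, C • B = cubeSumCurve (p : ℚ))
    (hA : ∃ C : VariableChange ℚ, C • A = cubeSumCurve (3 * (p : ℚ) ^ 2))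
    (hB2 : Nat.card (AddCommGroup.primaryComponent B.sha 2) = 1)
    (hA2 : Nat.card (AddCommGroup.primaryComponent A.sha 2) = 1) :
    MissingUpperBoundAt B 2 := by
  obtain ⟨qB, qA, hqB, hqA, hne, n, hn⟩ := hBC p hp h9 h3 A B hB hA
  refine (missingUpperBoundAt_iff_pairBound hHSY hCM0 hmod hp h9 h3 A B hB hA).mpr
    ⟨qB, qA, hqB, hqA, hne, ?_⟩
  rw [hB2, hA2, hn]
  simp only [padicValNat_one_right, Nat.cast_zero, add_zero]
  positivity

/-- **`𝒱₀` layer, frame form**: under `hBC` and the facts (now the whole of `PublishedFactsTwo`, for the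
frame machinery), at a member `W ≅ E_p` with `#Ш(W)[2^∞] = 1` whose partner models all have
`#Ш(A)[2^∞] = 1`, the crux's inequality `ord₂ #Ш(W) ≤ ord₂ 𝔮` holds in EVERY Heegner frame
(p418375 `upperInstance_of_missingUpperBoundAt`). [cite: HuShuYin2019, Cor. 4.4 and (bsd) p. 12]
[cite: BurungaleFlach2024, Thm. 1.1 and Cor. 2] [cite: Miller2011LMS, Def. 1.1] -/
theorem upperInstance_onV0_of_twoAdicPair (hF : PublishedFactsTwo)
    {p : ℕ} (hp : p.Prime) (h9 : p % 9 = 4 ∨ p % 9 = 7) (h3 : ¬ ∃ x : ZMod p, x ^ 3 = 3)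
    (A W : WeierstrassCurve ℚ) [A.IsElliptic] [A.IsGloballyMinimal] [W.IsElliptic]
    [W.IsGloballyMinimal] (hW : ∃ C : VariableChange ℚ, C • W = cubeSumCurve (p : ℚ))
    (hA : ∃ C : VariableChange ℚ, C • A = cubeSumCurve (3 * (p : ℚ) ^ 2))
    (hW2 : Nat.card (AddCommGroup.primaryComponent W.sha 2) = 1)
    (hA2 : Nat.card (AddCommGroup.primaryComponent A.sha 2) = 1)
    (N : ℕ) [NeZero N] (K : Type) [Field K] [NumberField K]
    (Dt : ModularForms.ModularParametrizationData W N) (H : HeegnerDatum N (NumberField.discr K))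
    (ι : K →+* ℂ) (P : (W.baseChange K).toAffine.Point) (hK : IsImaginaryQuadratic K)
    (hHN : SatisfiesHeegnerHypothesis N K)
    (hP : WeierstrassCurve.Affine.Point.map ι.toRatAlgHom P = ModularForms.heegnerPointComplex Dt H)
    (hLt : (W.quadraticTwist (NumberField.discr K : ℚ)).entireLFunction 1 ≠ 0)
    (Wd : WeierstrassCurve ℚ) [Wd.IsElliptic] [Wd.IsGloballyMinimal] (Cd : VariableChange ℚ)
    (hWd : Cd • W.quadraticTwist (NumberField.discr K : ℚ) = Wd) (k : ℕ) (hk12 : k = 1 ∨ k = 2)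
    (hkiff : k = 2 ↔ ∀ y : W.toAffine.Point, ∃ Q : (W.baseChange K).toAffine.Point,
      QuadraticDescent.incl K W y - (2 : ℤ) • Q ∈ AddCommGroup.torsion (W.baseChange K).toAffine.Point) :
    (padicValNat 2 (Nat.card W.sha) : ℤ) ≤
      padicValRat 2 (P2.cmHeegnerIndexQuotient W K P Dt.c k Wd Cd.u) := by
  have hF' := hF
  obtain ⟨hHSY, hCM0, hmod, -, -, hGZ, hKo, hGZK, -⟩ := hF'
  obtain ⟨hr, -, -⟩ := X12.CubeSumFamilies.bsdp_three_of_thm14' hHSY hCM0 hmod hp h9 h3 W hW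
  exact upperInstance_of_missingUpperBoundAt W N K Dt H ι P (hGZ N W K) (hKo N W K) hGZK hmod hCM0
    (X12.Sylvester.hasCM_of_model W hW) hr hK hHN hP hLt Wd Cd hWd k hk12 hkiff
    (missingUpperBoundAt_onV0_of_twoAdicPair hBC hHSY hCM0 hmod hp h9 h3 A W hW hA hW2 hA2)

/-- **THE CRUX ⟺ THE INDEX BOUND, modulo the binder.** Granted `hBC`, `HeegnerIndexUpperAtTwoHSYOfFacts`
holds iff, granted the facts, for all members and partners and THE `n` of the binder
(`ord₂ (#Ш_an(B)·#Ш_an(A)) = 2n`; `n = m(p) + i/2`, the normalised `2`-adic valuation of Hu–Shu–Yin's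
`ℤ[ω]`-Heegner index): `ord₂ #Ш(B)[2^∞] + ord₂ #Ш(A)[2^∞] ≤ 2n` — a SHARP `2`-adic Kolyvagin bound for
the pair `(E_p, E_{3p²})` with constant ZERO (Kolyvagin 1990 / McCallum 1991 §1 give
`ord_p #Ш(E/K) ≤ 2 ord_p [E(K) : ℤ y_K]` only for `p` ODD). The planner's `UpperOffV0` made uniform;
OPEN, nothing asserted. [cite: Kolyvagin1990, Thm. A] [cite: McCallumLMS1991, §1 Theorem (Kolyvagin), p. 296]
[cite: HuShuYin2019, Cor. 4.4 and (bsd) p. 12] -/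
theorem upperOfFacts_iff_indexBound_of_twoAdicPair :
    HeegnerIndexUpperAtTwoHSYOfFacts ↔
      (PublishedFactsTwo → ∀ (p : ℕ), p.Prime → (p % 9 = 4 ∨ p % 9 = 7) → (¬ ∃ x : ZMod p, x ^ 3 = 3) →
        ∀ (A B : WeierstrassCurve ℚ) [A.IsElliptic] [A.IsGloballyMinimal] [B.IsElliptic]
          [B.IsGloballyMinimal], (∃ C : VariableChange ℚ, C • B = cubeSumCurve (p : ℚ)) →
          (∃ C : VariableChange ℚ, C • A = cubeSumCurve (3 * (p : ℚ) ^ 2)) →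
          ∀ (qB qA : ℚ), shaAn B = (qB : ℂ) → shaAn A = (qA : ℂ) →
            ∀ n : ℕ, padicValRat 2 (qB * qA) = 2 * n →
              padicValNat 2 (Nat.card (AddCommGroup.primaryComponent B.sha 2)) +
                padicValNat 2 (Nat.card (AddCommGroup.primaryComponent A.sha 2)) ≤ 2 * n) := by
  rw [upperOfFacts_iff_pairBound]
  refine ⟨fun h hF p hp h9 h3 A B _ _ _ _ hB hA qB qA hqB hqA n hn => ?_,
    fun h hF p hp h9 h3 A B _ _ _ _ hB hA => ?_⟩
  · obtain ⟨qB', qA', hqB', hqA', -, hle⟩ := h hF p hp h9 h3 A B hB hA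
    have hqq : qB' = qB := by exact_mod_cast hqB'.symm.trans hqB
    have hqq' : qA' = qA := by exact_mod_cast hqA'.symm.trans hqA
    subst hqq hqq'
    rw [hn] at hle
    exact_mod_cast hle
  · obtain ⟨qB, qA, hqB, hqA, hne, n, hn⟩ := hBC p hp h9 h3 A B hB hA
    refine ⟨qB, qA, hqB, hqA, hne, ?_⟩
    rw [hn]
    exact_mod_cast h hF p hp h9 h3 A B hB hA qB qA hqB hqA n hn

/-- **GLUE: the binder + the OFF-`𝒱₀` piece ⇒ the crux.** Granted `hBC` and the planner's second layer
`UpperOffV0` (displayed: granted the facts, every member/partner pair with `#Ш(B)[2^∞] ≠ 1 ∨ #Ш(A)[2^∞] ≠ 1`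
satisfies `MissingUpperBoundAt B 2` — the sharp `2`-adic Kolyvagin theorem for a `ℤ[ω]`-CM curve, XL,
not in print), the crux `HeegnerIndexUpperAtTwoHSYOfFacts` follows: by cases on `𝒱₀` for an
existentially chosen minimal partner `A` (Silverman VIII.8.3), the `𝒱₀` case being
`missingUpperBoundAt_onV0_of_twoAdicPair`. Composition only; both inputs OPEN in the kernel.
[cite: Kolyvagin1990, Thm. A] [cite: HuShuYin2019, Cor. 4.4 and (bsd) p. 12]
[cite: SilvermanAEC2009, VIII.8 Cor. 8.3] -/
theorem upperOfFacts_of_twoAdicPair_of_offV0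
    (hoff : PublishedFactsTwo → ∀ (p : ℕ), p.Prime → (p % 9 = 4 ∨ p % 9 = 7) →
      (¬ ∃ x : ZMod p, x ^ 3 = 3) →
      ∀ (A B : WeierstrassCurve ℚ) [A.IsElliptic] [A.IsGloballyMinimal] [B.IsElliptic]
        [B.IsGloballyMinimal], (∃ C : VariableChange ℚ, C • B = cubeSumCurve (p : ℚ)) →
        (∃ C : VariableChange ℚ, C • A = cubeSumCurve (3 * (p : ℚ) ^ 2)) →
        ¬ (Nat.card (AddCommGroup.primaryComponent B.sha 2) = 1 ∧
            Nat.card (AddCommGroup.primaryComponent A.sha 2) = 1) →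
        MissingUpperBoundAt B 2) :
    HeegnerIndexUpperAtTwoHSYOfFacts := by
  rw [upperOfFacts_iff_missingUpperBoundAt]
  intro hF p hp h9 h3 B _ _ hB
  have hF' := hF
  obtain ⟨hHSY, hCM0, hmod, -⟩ := hF'
  have hn : (3 * (p : ℚ) ^ 2) ≠ 0 :=
    mul_ne_zero (by norm_num) (pow_ne_zero _ (Nat.cast_ne_zero.mpr hp.ne_zero))
  haveI := X12.CubeSumFamilies.isElliptic_cubeSumCurve hn
  obtain ⟨A, _, _, CA, hCA⟩ :=
    X12.CubeSumFamilies.exists_isGloballyMinimal_model (cubeSumCurve (3 * (p : ℚ) ^ 2))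
  by_cases hV0 : Nat.card (AddCommGroup.primaryComponent B.sha 2) = 1 ∧
      Nat.card (AddCommGroup.primaryComponent A.sha 2) = 1
  · exact missingUpperBoundAt_onV0_of_twoAdicPair hBC hHSY hCM0 hmod hp h9 h3 A B hB ⟨CA, hCA⟩
      hV0.1 hV0.2
  · exact hoff hF p hp h9 h3 A B hB ⟨CA, hCA⟩ hV0

/-- **PARITY, modulo the binder** (memo Cor B1's shape): `ord₂ #Ш_an(E_p) + ord₂ #Ш(E_{3p²})[2^∞]`
is EVEN — so `ord₂ #Ш_an(E_p)` is even exactly when `ord₂ #Ш(E_{3p²})` is (Cassels–Tate on the finite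
`Ш(E_{3p²})` makes the latter even; not invoked here). [cite: HuShuYin2019, (bsd) p. 12]
[cite: BurungaleFlach2024, Thm. 1.1 and Cor. 2] -/
theorem even_padicVal_of_twoAdicPair
    (hHSY : thm14_threePart_product) (hCM0 : bsdTriple_of_hasCM_of_L_one_ne_zero)
    (hmod : hasEntireLFunction_rat)
    {p : ℕ} (hp : p.Prime) (h9 : p % 9 = 4 ∨ p % 9 = 7) (h3 : ¬ ∃ x : ZMod p, x ^ 3 = 3)
    (A B : WeierstrassCurve ℚ) [A.IsElliptic] [A.IsGloballyMinimal] [B.IsElliptic]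
    [B.IsGloballyMinimal] (hB : ∃ C : VariableChange ℚ, C • B = cubeSumCurve (p : ℚ))
    (hA : ∃ C : VariableChange ℚ, C • A = cubeSumCurve (3 * (p : ℚ) ^ 2)) :
    ∃ qB : ℚ, shaAn B = (qB : ℂ) ∧ qB ≠ 0 ∧
      Even (padicValRat 2 qB + padicValNat 2 (Nat.card (AddCommGroup.primaryComponent A.sha 2))) := by
  haveI : Fact (2 : ℕ).Prime := ⟨Nat.prime_two⟩
  obtain ⟨-, -, qB, qA, hqB, hqA, hqB0, hqA0, hvA⟩ :=
    pair_shaAn_two hHSY hCM0 hmod hp h9 h3 A B hB hA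
  obtain ⟨qB', qA', hqB', hqA', -, n, hn⟩ := hBC p hp h9 h3 A B hB hA
  have hqq : qB' = qB := by exact_mod_cast hqB'.symm.trans hqB
  have hqq' : qA' = qA := by exact_mod_cast hqA'.symm.trans hqA
  subst hqq hqq'
  refine ⟨qB', hqB, hqB0, n, ?_⟩
  rw [← hvA, ← padicValRat.mul hqB0 hqA0, hn]
  ring

end Binder

/-- **For item 19477 (LOWER): the unit case is free** (binder-free; the displayed value is the only
input). If `ord₂ (#Ш_an(E_p)·#Ш_an(E_{3p²})) = 0` at a member/partner pair — Hu–Shu–Yin's Heegner point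
has the minimal `2`-divisibility: every certified 𝒰 member (`m(p) = 0`) and every `p ≡ 7 (mod 9)` with
`m(p) = 1` — then `MissingLowerBoundAt B 2` holds outright: `0 ≤ ord₂ #Ш(B)[2^∞] + ord₂ #Ш(A)[2^∞]`
(k7t-c3's `lower_frame_of_shaAn_odd` in pair form). [cite: HuShuYin2019, Cor. 4.4 and (bsd) p. 12]
[cite: BurungaleFlach2024, Thm. 1.1 and Cor. 2] [cite: Miller2011LMS, Def. 1.1] -/
theorem missingLowerBoundAt_of_pair_unit (hHSY : thm14_threePart_product)
    (hCM0 : bsdTriple_of_hasCM_of_L_one_ne_zero) (hmod : hasEntireLFunction_rat)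
    {p : ℕ} (hp : p.Prime) (h9 : p % 9 = 4 ∨ p % 9 = 7) (h3 : ¬ ∃ x : ZMod p, x ^ 3 = 3)
    (A B : WeierstrassCurve ℚ) [A.IsElliptic] [A.IsGloballyMinimal] [B.IsElliptic]
    [B.IsGloballyMinimal] (hB : ∃ C : VariableChange ℚ, C • B = cubeSumCurve (p : ℚ))
    (hA : ∃ C : VariableChange ℚ, C • A = cubeSumCurve (3 * (p : ℚ) ^ 2))
    {qB qA : ℚ} (hqB : shaAn B = (qB : ℂ)) (hqA : shaAn A = (qA : ℂ))
    (h0 : padicValRat 2 (qB * qA) = 0) : MissingLowerBoundAt B 2 := by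
  obtain ⟨-, -, qB', qA', hqB', hqA', hqB0, hqA0, -⟩ :=
    pair_shaAn_two hHSY hCM0 hmod hp h9 h3 A B hB hA
  have hqq : qB' = qB := by exact_mod_cast hqB'.symm.trans hqB
  have hqq' : qA' = qA := by exact_mod_cast hqA'.symm.trans hqA
  subst hqq hqq'
  refine (missingLowerBoundAt_iff_pairBound hHSY hCM0 hmod hp h9 h3 A B hB hA).mpr
    ⟨qB', qA', hqB, hqA, mul_ne_zero hqB0 hqA0, ?_⟩
  rw [h0]
  positivity

end Summit.BirchSwinnertonDyer.BirchSwinnertonDyer.Theorems.SylvesterTwoUpper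

end
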